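import Mathlib
import HarnessLib
import Summits.HubbardSuperconductivity.HubbardSuperconductivity.Theorems.KLProgrammeSWaveCascadeArrayEdge

/-!
# Route `KLProgramme` — row 0′ (child 1), CARRIER-GENERIC, with the Riccati COMPARISON SEQUENCE EXPORTED AT ALL SCALES:
# the exact cascade law `u_{i+1} = u_i/(1 + W_i u_i)`, the signed masses, quasi-monotonicity and total variation in `U`-currency

Cell gate-hubbard-kl, seat hubbard-kl-k3c1-p1 (g19; child-1 lineage; technique «composed-map remainder propagation»).  Context: pen g25 (R366)(q-α2) /
(R367)(2)(k-1) / (R372)(B) «CHILD1-ALLSCALES-EXPORT» (cell STATUS 2026-08-29T05:15–05:32Z).  The accepted row-0′ theorems `matrixLadder_envelope_edge`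
(`…SWaveCascadeMatrixEdge`), `amplitudeLadder_envelope_edge` (ibid.) and `amplitudeArray_envelope_edge` (`…SWaveCascadeArrayEdge`) conclude
`∃ u ∈ [0, (16/15)·U]` with the envelope at the LAST scale `n` only — the comparison value `u` is re-chosen per scale by the STATEMENT, although the PROOF
constructs the whole Riccati comparison sequence `Us 0 = U`, `Us (i+1) = Us i/(1 + W_i·Us i)` (`W_i = Σ_u w_i(u)` the signed ladder mass on the ball) and
the all-scales envelope `sWaveCascade_envelope_edge` (`…SWaveCascadeEdge`: `∀ i ≤ N`).  This file RE-ENDS those proofs (proofs adapted verbatim from the two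
files named; no registered text and no landed file is touched) so that the sequence is EXPORTED together with its cross-scale law:

* §1 the scalar cascade `U_{i+1} = U_i/(1 + W_i U_i)` under the negative-mass floor `W_i ≥ −ν_i`, `16·U_0·Σ_{j<N} ν_j ≤ 1` (`sWaveFloor_*`,
  `…SWaveCascadeEdgeAlgebra`): the exact increment `U_{i+1} − U_i = −W_i·U_i·U_{i+1}` (**`sWaveFloor_succ_sub`**), one-step quasi-monotonicity
  `U_{i+1} ≤ U_i + (16U_0/15)²·ν_i` and the Lipschitz step `|U_{i+1} − U_i| ≤ (16U_0/15)²·|W_i|` (**`sWaveFloor_succ_le`**), the telescoped form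
  `U_j ≤ U_i + (16U_0/15)²·Σ_{m∈[i,j)} ν_m` (**`sWaveFloor_le_add_sum`**) and the total variation `Σ_{i<N} |U_{i+1} − U_i| ≤ U_0 − U_N + 2(16U_0/15)²·Σν ≤ (257/225)·U_0`
  (**`sWaveFloor_totalVariation_le`**, **`sWaveFloor_totalVariation_le'`**) — the comparison values are DECREASING up to a summable remainder whose scale sum is
  `≤ (16/225)·U_0` from the negative-mass line ALONE;
* §2 **`matrixLadder_envelope_edge_allScales`** / **`amplitudeLadder_envelope_edge_allScales`**: the hypotheses of `matrixLadder_envelope_edge` /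
  `amplitudeLadder_envelope_edge` VERBATIM ⟹ `∃ Us W m : ℕ → ℝ` with `Us 0 = U`, the exact law, `|W_i| ≤ m_i`, `m_i ≤ b` and `m_i − W_i ≤ δ_i` for `i < n`,
  `W_i = m_i = 0` for `i ≥ n`, the negative-mass line `16·U·Σ_{i<n}(m_i − W_i) ≤ 1`, and for EVERY `i ≤ n`: `0 ≤ Us i ≤ (16/15)·U` and
  `‖C i k k' − Us i‖ ≤ 12·(A + R)` on `B × B` (same `A`, `R` as at scale `n`);
* (next file `…SWaveCascadeArrayAllScales`) `amplitudeArray_envelope_edge_allScales`: the same with the class structure of `amplitudeArray_envelope_edge`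
  (frozen comparison value past the class exit); then the model instance `…KLRegimeSplitFlowPairArrayEdgeAllScales` (scheme F-II carrier).

So the history of ONE run hands ONE comparison sequence whose TOTAL VARIATION is `U`-currency (`≤ (257/225)·U`) — the cross-scale link (R367) found absent from
the exported predicate `PairArrayAtV17F`.  Everything is proved; no definitions; nothing about the model is asserted; nothing asserts superconductivity.
-/

noncomputable section

namespace Summit.HubbardSuperconductivity.HubbardSuperconductivity.Theorems.SWaveCascade

set_option linter.dupNamespace false -- summit = problem name (single-conjunct summit), D-0017

open Finset

/-! ## §1 The scalar cascade with a negative-mass floor: exact increments, quasi-monotonicity, total variation -/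

section Scalar

variable {U W ν : ℕ → ℝ} {N : ℕ}

/-- The exact increment of the cascade `U_{n+1} = U_n/(1 + W_n U_n)` when `0 < 1 + W_n U_n`: `U_{n+1} − U_n = −W_n·U_n·U_{n+1}`. -/
theorem sWaveFloor_succ_sub (hU : ∀ n, U (n + 1) = U n / (1 + W n * U n)) {n : ℕ} (hden : 0 < 1 + W n * U n) :
    U (n + 1) - U n = -(W n * U n * U (n + 1)) := by
  have h : U (n + 1) * (1 + W n * U n) = U n := by rw [hU n, div_mul_cancel₀ _ hden.ne']
  linear_combination h

/-- **One-step quasi-monotonicity and the Lipschitz step.**  Under `U_0 ≥ 0`, the cascade law, `W_n ≥ −ν_n`, `ν_n ≥ 0` and `16·U_0·Σ_{j<N} ν_j ≤ 1`: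
for every `n < N`, `U_{n+1} ≤ U_n + (16U_0/15)²·ν_n` and `|U_{n+1} − U_n| ≤ (16U_0/15)²·|W_n|`. -/
theorem sWaveFloor_succ_le (h0 : 0 ≤ U 0) (hU : ∀ n, U (n + 1) = U n / (1 + W n * U n)) (hWν : ∀ n, -ν n ≤ W n)
    (hν0 : ∀ n, 0 ≤ ν n) (hsmall : 16 * U 0 * ∑ j ∈ range N, ν j ≤ 1) :
    ∀ n < N, U (n + 1) ≤ U n + (16 / 15 * U 0) ^ 2 * ν n ∧ |U (n + 1) - U n| ≤ (16 / 15 * U 0) ^ 2 * |W n| := by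
  intro n hn
  obtain ⟨hUn, hUnle⟩ := sWaveFloor_bounds h0 hU hWν hν0 hsmall n hn.le
  obtain ⟨hUn1, hUn1le⟩ := sWaveFloor_bounds h0 hU hWν hν0 hsmall (n + 1) (Nat.succ_le_of_lt hn)
  have hden := (sWaveFloor_step h0 hU hWν hν0 hsmall n hn).1
  have hΔ := sWaveFloor_succ_sub hU hden
  have hprod0 : 0 ≤ U n * U (n + 1) := mul_nonneg hUn hUn1
  have hprod : U n * U (n + 1) ≤ (16 / 15 * U 0) ^ 2 := by
    rw [sq]; exact mul_le_mul hUnle hUn1le hUn1 (by positivity)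
  refine ⟨?_, ?_⟩
  · have h1 : -(W n * U n * U (n + 1)) ≤ ν n * (U n * U (n + 1)) := by nlinarith [hWν n]
    have h2 : ν n * (U n * U (n + 1)) ≤ ν n * (16 / 15 * U 0) ^ 2 := mul_le_mul_of_nonneg_left hprod (hν0 n)
    linarith
  · rw [hΔ, abs_neg, show W n * U n * U (n + 1) = W n * (U n * U (n + 1)) by ring, abs_mul, abs_of_nonneg hprod0, mul_comm]
    exact mul_le_mul_of_nonneg_right hprod (abs_nonneg _)

/-- **Quasi-monotonicity, telescoped**: for `i ≤ j ≤ N`, `U_j ≤ U_i + (16U_0/15)²·Σ_{m ∈ [i,j)} ν_m` — the comparison values DECREASE up to the cumulated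
sign defect (remainder propagation along the composed cascade maps). -/
theorem sWaveFloor_le_add_sum (h0 : 0 ≤ U 0) (hU : ∀ n, U (n + 1) = U n / (1 + W n * U n)) (hWν : ∀ n, -ν n ≤ W n)
    (hν0 : ∀ n, 0 ≤ ν n) (hsmall : 16 * U 0 * ∑ j ∈ range N, ν j ≤ 1) :
    ∀ i j, i ≤ j → j ≤ N → U j ≤ U i + (16 / 15 * U 0) ^ 2 * ∑ m ∈ Ico i j, ν m := by
  intro i j hij hjN
  induction j, hij using Nat.le_induction with
  | base => simp
  | succ j hij ih =>
    have ih' := ih (Nat.le_of_succ_le hjN)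
    have hstep := (sWaveFloor_succ_le h0 hU hWν hν0 hsmall j (Nat.lt_of_succ_le hjN)).1
    rw [sum_Ico_succ_top hij, mul_add]
    linarith

/-- **Total variation of the comparison sequence**: `Σ_{n<N} |U_{n+1} − U_n| ≤ (U_0 − U_N) + 2·(16U_0/15)²·Σ_{n<N} ν_n`. -/
theorem sWaveFloor_totalVariation_le (h0 : 0 ≤ U 0) (hU : ∀ n, U (n + 1) = U n / (1 + W n * U n)) (hWν : ∀ n, -ν n ≤ W n)
    (hν0 : ∀ n, 0 ≤ ν n) (hsmall : 16 * U 0 * ∑ j ∈ range N, ν j ≤ 1) :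
    ∑ n ∈ range N, |U (n + 1) - U n| ≤ (U 0 - U N) + 2 * (16 / 15 * U 0) ^ 2 * ∑ n ∈ range N, ν n := by
  have key : ∀ n < N, |U (n + 1) - U n| ≤ 2 * ((16 / 15 * U 0) ^ 2 * ν n) - (U (n + 1) - U n) := by
    intro n hn
    have h1 := (sWaveFloor_succ_le h0 hU hWν hν0 hsmall n hn).1
    have hr0 : 0 ≤ (16 / 15 * U 0) ^ 2 * ν n := mul_nonneg (sq_nonneg _) (hν0 n)
    rcases le_or_gt 0 (U (n + 1) - U n) with h | h
    · rw [abs_of_nonneg h]; linarith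
    · rw [abs_of_neg h]; linarith
  calc ∑ n ∈ range N, |U (n + 1) - U n|
      ≤ ∑ n ∈ range N, (2 * ((16 / 15 * U 0) ^ 2 * ν n) - (U (n + 1) - U n)) :=
        sum_le_sum fun n hn => key n (mem_range.1 hn)
    _ = 2 * (16 / 15 * U 0) ^ 2 * ∑ n ∈ range N, ν n - (U N - U 0) := by
        rw [sum_sub_distrib, Finset.sum_range_sub, ← mul_sum, ← mul_sum, mul_assoc]
    _ = (U 0 - U N) + 2 * (16 / 15 * U 0) ^ 2 * ∑ n ∈ range N, ν n := by ring

/-- … hence, by `U_N ≥ 0` and the negative-mass line, `Σ_{n<N} |U_{n+1} − U_n| ≤ (257/225)·U_0`: the total variation is `U`-currency. -/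
theorem sWaveFloor_totalVariation_le' (h0 : 0 ≤ U 0) (hU : ∀ n, U (n + 1) = U n / (1 + W n * U n)) (hWν : ∀ n, -ν n ≤ W n)
    (hν0 : ∀ n, 0 ≤ ν n) (hsmall : 16 * U 0 * ∑ j ∈ range N, ν j ≤ 1) :
    ∑ n ∈ range N, |U (n + 1) - U n| ≤ 257 / 225 * U 0 := by
  have h := sWaveFloor_totalVariation_le h0 hU hWν hν0 hsmall
  have hN := (sWaveFloor_bounds h0 hU hWν hν0 hsmall N le_rfl).1
  have hs0 : 0 ≤ ∑ j ∈ range N, ν j := sum_nonneg fun j _ => hν0 j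
  have h2 : 2 * (16 / 15 * U 0) ^ 2 * ∑ n ∈ range N, ν n = 32 / 225 * U 0 * (16 * U 0 * ∑ j ∈ range N, ν j) := by ring
  rw [h2] at h
  nlinarith [mul_le_mul_of_nonneg_left hsmall (by positivity : (0 : ℝ) ≤ 32 / 225 * U 0)]

end Scalar

/-! ## §2 Row 0′ at matrix level with the comparison sequence exported at all scales -/

variable {S : Type*} [Fintype S] [DecidableEq S]

/-- **Row 0′, in-class ladder part, at matrix level for an arbitrary carrier — ALL-SCALES EXPORT.**  Hypotheses = those of `matrixLadder_envelope_edge`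
verbatim.  Conclusion: the Riccati comparison sequence `Us` (with `Us 0 = U` and the exact law `Us (i+1) = Us i/(1 + W i·Us i)`), the signed net masses
`W i` and the ℓ¹ masses `m i` of the ladder weights restricted to the ball (`|W i| ≤ m i`; `m i ≤ b`, `m i − W i ≤ δ i` for `i < n`; `W i = m i = 0` for
`i ≥ n`), the negative-mass line `16·U·Σ_{i<n}(m i − W i) ≤ 1`, and at EVERY scale `i ≤ n`: `0 ≤ Us i ≤ (16/15)·U` and
`‖C i k k' − Us i‖ ≤ 12·((ι₀ + Στ + Xtot) + (Στ + Xsup))` on `B × B`.  Proof = `matrixLadder_envelope_edge`'s, re-ended in `hmain i hi`. -/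
theorem matrixLadder_envelope_edge_allScales (B : Finset S) (C : ℕ → Matrix S S ℂ) (hCsupp : ∀ i u, u ∉ B → ∀ t, C i u t = 0)
    {U b ι₀ : ℝ} (hU : 0 ≤ U) (hι₀ : 0 ≤ ι₀) (τ : ℕ → ℝ) (hτ0 : ∀ j, 0 ≤ τ j) {n : ℕ}
    (X : ℕ → S → S → ℝ) {Xtot Xsup : ℝ} (hX0 : ∀ j k k', 0 ≤ X j k k')
    (hXsup : ∀ i < n, ∀ k k', X (i + 1) k k' ≤ Xsup) (hXtot : ∀ k k', X 0 k k' + ∑ i ∈ range n, X (i + 1) k k' ≤ Xtot)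
    (hXtot0 : 0 ≤ Xtot) (hXsup0 : 0 ≤ Xsup) (δ : ℕ → ℝ) (hneg : 16 * U * ∑ i ∈ range n, δ i ≤ 1)
    (h0 : ∀ k ∈ B, ∀ k' ∈ B, ‖C 0 k k' - (U : ℂ)‖ ≤ ι₀ + X 0 k k')
    (hsteps : ∀ i < n, ∃ w : S → ℝ, (∑ p, |w p| ≤ b) ∧ (∑ p, (|w p| - w p) ≤ δ i) ∧
      ∃ N : Matrix S S ℂ, (1 + Matrix.diagonal (fun p => (w p : ℂ)) * C i) * N = 1 ∧
        ∀ k ∈ B, ∀ k' ∈ B, ‖C (i + 1) k k' - (C i * N) k k'‖ ≤ τ i + X (i + 1) k k')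
    (hsmall : 8 * 42 * ((ι₀ + ∑ j ∈ range n, τ j + Xtot) + (∑ j ∈ range n, τ j + Xsup)) * (b * n) ≤ 1) :
    ∃ Us W m : ℕ → ℝ, Us 0 = U ∧ (∀ i, Us (i + 1) = Us i / (1 + W i * Us i)) ∧
      (∀ i, |W i| ≤ m i) ∧ (∀ i < n, m i ≤ b ∧ m i - W i ≤ δ i) ∧ (∀ i, n ≤ i → W i = 0 ∧ m i = 0) ∧
      16 * U * ∑ i ∈ range n, (m i - W i) ≤ 1 ∧
      ∀ i ≤ n, 0 ≤ Us i ∧ Us i ≤ 16 / 15 * U ∧ ∀ k ∈ B, ∀ k' ∈ B,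
        ‖C i k k' - (Us i : ℂ)‖ ≤ 12 * ((ι₀ + ∑ j ∈ range n, τ j + Xtot) + (∑ j ∈ range n, τ j + Xsup)) := by
  classical
  -- notation
  set Sτ : ℝ := ∑ j ∈ range n, τ j with hSτ
  have hSτ0 : 0 ≤ Sτ := sum_nonneg fun j _ => hτ0 j
  have hτle : ∀ i < n, τ i ≤ Sτ := fun i hi =>
    single_le_sum (f := τ) (fun j _ => hτ0 j) (mem_range.2 hi)
  set A : ℝ := ι₀ + Sτ + Xtot with hA
  set R : ℝ := Sτ + Xsup with hR
  have hA0 : 0 ≤ A := by positivity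
  -- the step data
  choose! wt hwtabs hwtneg Nm hNm happ using hsteps
  -- the matrices Δ, T and the full-carrier implicit step
  set Δ : ℕ → Matrix S S ℂ := fun i => C (i + 1) - C i * Nm i with hΔ
  set T : ℕ → Matrix S S ℂ :=
    fun i => Δ i + Δ i * Matrix.diagonal (fun p => (wt i p : ℂ)) * C i with hT
  have hfull : ∀ i < n, C (i + 1) = C i - C (i + 1) * Matrix.diagonal (fun p => (wt i p : ℂ)) * C i + T i :=
    fun i hi => implicit_step_of_rightInverse (wt i) (hNm i hi) (by simp only [hΔ]; abel)
  -- restriction to the ball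
  set 𝒞r : ℕ → ↥B → ↥B → ℂ := fun i => resArr B (C i) with h𝒞r
  set wr : ℕ → ↥B → ℝ := fun i u => if i < n then wt i u.1 else 0 with hwr
  set Δr : ℕ → ↥B → ↥B → ℂ := fun i => resArr B (Δ i) with hΔr
  have hwr_eq : ∀ i < n, wr i = fun u : ↥B => wt i u.1 := fun i hi => funext fun u => if_pos hi
  have hwr_zero : ∀ i, n ≤ i → wr i = fun _ : ↥B => 0 := fun i hi => funext fun u => if_neg (not_lt.2 hi)
  -- the masses on the ball: ℓ¹ `≤ b`, sign defect `≤ δ`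
  have hmr : ∀ i < n, ∑ u, |wr i u| ≤ b := fun i hi => by
    rw [hwr_eq i hi]
    calc ∑ u : ↥B, |wt i u.1| = ∑ u ∈ B, |wt i u| := Finset.sum_coe_sort B (fun u => |wt i u|)
      _ ≤ ∑ u, |wt i u| := sum_le_sum_of_subset_of_nonneg (subset_univ B) fun u _ _ => abs_nonneg _
      _ ≤ b := hwtabs i hi
  have hmr0 : ∀ i, 0 ≤ ∑ u, |wr i u| := fun i => sum_nonneg fun u _ => abs_nonneg _
  have hνr : ∀ i < n, (∑ u, |wr i u|) - ∑ u, wr i u ≤ δ i := fun i hi => by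
    rw [hwr_eq i hi, Finset.sum_coe_sort B (fun u => |wt i u|), Finset.sum_coe_sort B (wt i), ← sum_sub_distrib]
    calc ∑ u ∈ B, (|wt i u| - wt i u) ≤ ∑ u, (|wt i u| - wt i u) :=
          sum_le_sum_of_subset_of_nonneg (subset_univ B) fun u _ _ => sub_nonneg.2 (le_abs_self _)
      _ ≤ δ i := hwtneg i hi
  have hTr_eq : ∀ i < n, resArr B (T i) = Δr i + wmul (wr i) (Δr i) (𝒞r i) := by
    intro i hi
    funext k k'
    have hw := congrFun (congrFun (resArr_wmul B (wt i) (Δ i) (C i) (hCsupp i)) k) k'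
    rw [← hwr_eq i hi] at hw
    simp only [resArr] at hw
    simp only [hT, h𝒞r, hΔr, Pi.add_apply, resArr, Matrix.add_apply, mul_diagonal_mul_apply_eq_wmul, hw]
  have hstepr : ∀ i < n, 𝒞r (i + 1) = 𝒞r i - wmul (wr i) (𝒞r (i + 1)) (𝒞r i) + resArr B (T i) := by
    intro i hi
    funext k k'
    have h := congrFun (congrFun (hfull i hi) k.1) k'.1
    have hw := congrFun (congrFun (resArr_wmul B (wt i) (C (i + 1)) (C i) (hCsupp i)) k) k'
    rw [← hwr_eq i hi] at hw
    simp only [resArr] at hw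
    rw [Matrix.add_apply, Matrix.sub_apply, mul_diagonal_mul_apply_eq_wmul, hw] at h
    simp only [h𝒞r, Pi.add_apply, Pi.sub_apply, resArr]
    exact h
  -- the repulsive scalar cascade on the ball
  obtain ⟨Us, hUs0, hUss⟩ : ∃ Us : ℕ → ℝ, Us 0 = U ∧ ∀ i, Us (i + 1) = Us i / (1 + (∑ u, wr i u) * Us i) :=
    ⟨fun i => Nat.rec U (fun i u => u / (1 + (∑ v, wr i v) * u)) i, rfl, fun i => rfl⟩
  have hUs0' : 0 ≤ Us 0 := by rw [hUs0]; exact hU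
  have hneg' : 16 * Us 0 * ∑ j ∈ range n, ((∑ u, |wr j u|) - ∑ u, wr j u) ≤ 1 := by
    rw [hUs0]
    refine le_trans ?_ hneg
    exact mul_le_mul_of_nonneg_left (sum_le_sum fun j hj => hνr j (mem_range.1 hj)) (by positivity)
  have hUs_nonneg : ∀ i ≤ n, 0 ≤ Us i := fun i hi =>
    (sWaveFloor_bounds (U := Us) (W := fun i => ∑ u, wr i u) (ν := fun i => (∑ u, |wr i u|) - ∑ u, wr i u) hUs0' hUss
      (fun i => show -((∑ u, |wr i u|) - ∑ u, wr i u) ≤ ∑ u, wr i u by linarith [hmr0 i])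
      (fun i => sub_nonneg.2 (sum_le_sum_abs (wr i))) hneg' i hi).1
  -- the split of the tail: core + column source
  set 𝒟r : ℕ → ↥B → ↥B → ℂ := fun i => 𝒞r i - ((Us i : ℝ) : ℂ) • onesArr with h𝒟r
  set Er : ℕ → ↥B → ↥B → ℂ := fun i => Δr i + wmul (wr i) (Δr i) (𝒟r i) with hEr
  set cr : ℕ → ↥B → ℂ := fun i s => ((Us i : ℝ) : ℂ) * ∑ u, Δr i s u * (wr i u : ℂ) with hcr
  have hsplit : ∀ i < n, resArr B (T i) = Er i + fun s _ => cr i s := by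
    intro i hi
    rw [hTr_eq i hi]
    have h𝒞 : 𝒞r i = ((Us i : ℝ) : ℂ) • onesArr + 𝒟r i := by simp only [h𝒟r]; abel
    funext s t
    simp only [hEr, hcr, Pi.add_apply]
    conv_lhs => rw [h𝒞]
    rw [wmul_add_right, wmul_smul_right]
    simp only [Pi.add_apply, Pi.smul_apply, smul_eq_mul, wmul_onesArr_right_eq]
    ring
  have hstep' : ∀ i < n, 𝒞r (i + 1) = 𝒞r i - wmul (wr i) (𝒞r (i + 1)) (𝒞r i) + (Er i + fun s _ => cr i s) := by
    intro i hi
    have h := hstepr i hi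
    rw [hsplit i hi] at h
    exact h
  -- the entrywise majorant of the remainder
  set e : ℕ → ↥B → ↥B → ℝ := fun i s t => τ i + X (i + 1) s.1 t.1 with he
  have he0 : ∀ i s t, 0 ≤ e i s t := fun i s t => add_nonneg (hτ0 i) (hX0 _ _ _)
  have hΔr_le : ∀ i < n, ∀ s t : ↥B, ‖Δr i s t‖ ≤ e i s t := by
    intro i hi s t
    have := happ i hi s.1 s.2 t.1 t.2
    simpa [hΔr, hΔ, resArr, Matrix.sub_apply, he] using this
  have he_le_R : ∀ i < n, ∀ s t : ↥B, e i s t ≤ R := by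
    intro i hi s t
    have h1 := hτle i hi
    have h2 := hXsup i hi s.1 t.1
    simp only [he, hR] at *
    linarith
  have hR0 : 0 ≤ R := by positivity
  have hΔr_sup : ∀ i < n, esup (Δr i) ≤ R := fun i hi =>
    esup_le (fun s t => (hΔr_le i hi s t).trans (he_le_R i hi s t)) hR0
  -- hypotheses of the cascade lemma
  have hE : ∀ i < n, ∀ s t, ‖Er i s t‖ ≤ e i s t + R * (∑ u, |wr i u|) * esup (𝒞r i - ((Us i : ℝ) : ℂ) • onesArr) := by
    intro i hi s t
    have h1 := hΔr_le i hi s t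
    have h2 : ‖wmul (wr i) (Δr i) (𝒟r i) s t‖ ≤ esup (Δr i) * (∑ u, |wr i u|) * esup (𝒟r i) :=
      (le_esup _ s t).trans (esup_wmul_le_abs (wr i) _ _)
    have h3 : esup (Δr i) * (∑ u, |wr i u|) * esup (𝒟r i) ≤ R * (∑ u, |wr i u|) * esup (𝒟r i) :=
      mul_le_mul_of_nonneg_right (mul_le_mul_of_nonneg_right (hΔr_sup i hi) (hmr0 i)) (esup_nonneg _)
    calc ‖Er i s t‖ = ‖Δr i s t + wmul (wr i) (Δr i) (𝒟r i) s t‖ := rfl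
      _ ≤ ‖Δr i s t‖ + ‖wmul (wr i) (Δr i) (𝒟r i) s t‖ := norm_add_le _ _
      _ ≤ e i s t + R * (∑ u, |wr i u|) * esup (𝒟r i) := by linarith
  have hc : ∀ i < n, ∀ s, ‖cr i s‖ ≤ Us i * (∑ u, |wr i u|) * R := by
    intro i hi s
    have h1 : ‖∑ u, Δr i s u * (wr i u : ℂ)‖ ≤ (∑ u, |wr i u|) * esup (Δr i) :=
      norm_sum_mul_le_abs fun u => le_esup (Δr i) s u
    calc ‖cr i s‖ = Us i * ‖∑ u, Δr i s u * (wr i u : ℂ)‖ := by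
          simp only [hcr, norm_mul, Complex.norm_real, Real.norm_eq_abs, abs_of_nonneg (hUs_nonneg i hi.le)]
      _ ≤ Us i * ((∑ u, |wr i u|) * R) :=
          mul_le_mul_of_nonneg_left (h1.trans (mul_le_mul_of_nonneg_left (hΔr_sup i hi) (hmr0 i))) (hUs_nonneg i hi.le)
      _ = Us i * (∑ u, |wr i u|) * R := by ring
  have ha : ∀ s t : ↥B, ‖𝒞r 0 s t - ((Us 0 : ℝ) : ℂ)‖ + ∑ j ∈ range n, e j s t ≤ A := by
    intro s t
    have h0' : ‖𝒞r 0 s t - ((Us 0 : ℝ) : ℂ)‖ ≤ ι₀ + X 0 s.1 t.1 := by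
      rw [hUs0]
      have := h0 s.1 s.2 t.1 t.2
      simpa [h𝒞r, resArr] using this
    have h1 : ∑ j ∈ range n, e j s t = Sτ + ∑ j ∈ range n, X (j + 1) s.1 t.1 := by
      simp only [he, hSτ, sum_add_distrib]
    have h2 := hXtot s.1 t.1
    rw [h1, hA]
    linarith
  have hsmall' : 8 * 42 * (A + R) * ∑ j ∈ range n, (∑ u, |wr j u|) ≤ 1 := by
    refine le_trans ?_ hsmall
    have hW : ∑ j ∈ range n, (∑ u, |wr j u|) ≤ b * n := by
      calc ∑ j ∈ range n, (∑ u, |wr j u|) ≤ ∑ j ∈ range n, b := sum_le_sum fun j hj => hmr j (mem_range.1 hj)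
        _ = b * n := by rw [sum_const, card_range, nsmul_eq_mul, mul_comm]
    have : 8 * 42 * (A + R) * ∑ j ∈ range n, (∑ u, |wr j u|) ≤ 8 * 42 * (A + R) * (b * n) :=
      mul_le_mul_of_nonneg_left hW (by positivity)
    refine this.trans (le_of_eq ?_)
    simp only [hA, hR, hSτ]
  -- the cascade lemma, at every scale
  have hmain := sWaveCascade_envelope_edge (w := wr) (𝒞 := 𝒞r) (E := Er) (c := cr) (e := e) (U := Us) (N := n)
    (a := A) (r := R) hUs0' hUss hstep' he0 hE hA0 ha hR0 hc hneg' hsmall'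
  -- the export
  refine ⟨Us, fun i => ∑ u, wr i u, fun i => ∑ u, |wr i u|, hUs0, hUss, fun i => abs_sum_le_sum_abs _ _,
    fun i hi => ⟨hmr i hi, hνr i hi⟩, fun i hi => ?_, by rw [hUs0] at hneg'; exact hneg', fun i hi => ?_⟩
  · simp only [hwr_zero i hi, abs_zero, sum_const_zero, and_self]
  obtain ⟨⟨hUi0, hUiU⟩, hdev⟩ := hmain i hi
  refine ⟨hUi0, by rw [hUs0] at hUiU; exact hUiU, fun k hk k' hk' => ?_⟩
  have hent := le_esup (𝒞r i - ((Us i : ℝ) : ℂ) • onesArr) ⟨k, hk⟩ ⟨k', hk'⟩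
  have heq : (𝒞r i - ((Us i : ℝ) : ℂ) • onesArr : ↥B → ↥B → ℂ) ⟨k, hk⟩ ⟨k', hk'⟩ = C i k k' - ((Us i : ℝ) : ℂ) := by
    simp only [Pi.sub_apply, Pi.smul_apply, smul_eq_mul, onesArr, mul_one, h𝒞r, resArr]
  rw [heq] at hent
  refine hent.trans (hdev.trans (le_of_eq ?_))
  simp only [hA, hR, hSτ]

/-- **Row 0′, in-class ladder part, for an arbitrary AMPLITUDE family read on the ball — ALL-SCALES EXPORT.**  Hypotheses = those of
`amplitudeLadder_envelope_edge` verbatim; conclusion = that of `matrixLadder_envelope_edge_allScales` for `𝒜`. -/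
theorem amplitudeLadder_envelope_edge_allScales (B : Finset S) (𝒜 : ℕ → S → S → ℂ)
    {U b ι₀ : ℝ} (hU : 0 ≤ U) (hι₀ : 0 ≤ ι₀) (τ : ℕ → ℝ) (hτ0 : ∀ j, 0 ≤ τ j) {n : ℕ}
    (X : ℕ → S → S → ℝ) {Xtot Xsup : ℝ} (hX0 : ∀ j k k', 0 ≤ X j k k')
    (hXsup : ∀ i < n, ∀ k k', X (i + 1) k k' ≤ Xsup) (hXtot : ∀ k k', X 0 k k' + ∑ i ∈ range n, X (i + 1) k k' ≤ Xtot)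
    (hXtot0 : 0 ≤ Xtot) (hXsup0 : 0 ≤ Xsup) (δ : ℕ → ℝ) (hneg : 16 * U * ∑ i ∈ range n, δ i ≤ 1)
    (h0 : ∀ k ∈ B, ∀ k' ∈ B, ‖𝒜 0 k k' - (U : ℂ)‖ ≤ ι₀ + X 0 k k')
    (hsteps : ∀ i < n, ∃ w : S → ℝ, (∑ p, |w p| ≤ b) ∧ (∑ p, (|w p| - w p) ≤ δ i) ∧
      ∃ N : Matrix S S ℂ,
        (1 + Matrix.diagonal (fun p => (w p : ℂ)) * Matrix.of (fun s t => if s ∈ B ∧ t ∈ B then 𝒜 i s t else 0)) * N = 1 ∧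
        ∀ k ∈ B, ∀ k' ∈ B,
          ‖𝒜 (i + 1) k k' - (Matrix.of (fun s t => if s ∈ B ∧ t ∈ B then 𝒜 i s t else 0) * N) k k'‖ ≤ τ i + X (i + 1) k k')
    (hsmall : 8 * 42 * ((ι₀ + ∑ j ∈ range n, τ j + Xtot) + (∑ j ∈ range n, τ j + Xsup)) * (b * n) ≤ 1) :
    ∃ Us W m : ℕ → ℝ, Us 0 = U ∧ (∀ i, Us (i + 1) = Us i / (1 + W i * Us i)) ∧
      (∀ i, |W i| ≤ m i) ∧ (∀ i < n, m i ≤ b ∧ m i - W i ≤ δ i) ∧ (∀ i, n ≤ i → W i = 0 ∧ m i = 0) ∧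
      16 * U * ∑ i ∈ range n, (m i - W i) ≤ 1 ∧
      ∀ i ≤ n, 0 ≤ Us i ∧ Us i ≤ 16 / 15 * U ∧ ∀ k ∈ B, ∀ k' ∈ B,
        ‖𝒜 i k k' - (Us i : ℂ)‖ ≤ 12 * ((ι₀ + ∑ j ∈ range n, τ j + Xtot) + (∑ j ∈ range n, τ j + Xsup)) := by
  have h := matrixLadder_envelope_edge_allScales B (fun i => Matrix.of fun s t => if s ∈ B ∧ t ∈ B then 𝒜 i s t else 0)
    (fun i u hu t => truncArr_apply_of_not_mem B (𝒜 i) hu t)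
    hU hι₀ τ hτ0 X hX0 hXsup hXtot hXtot0 hXsup0 δ hneg
    (fun k hk k' hk' => by rw [truncArr_apply_of_mem B (𝒜 0) hk hk']; exact h0 k hk k' hk')
    (fun i hi => by
      obtain ⟨w, hwabs, hwneg, N, hN, hb⟩ := hsteps i hi
      exact ⟨w, hwabs, hwneg, N, hN, fun k hk k' hk' => by
        rw [truncArr_apply_of_mem B (𝒜 (i + 1)) hk hk']; exact hb k hk k' hk'⟩)
    hsmall
  obtain ⟨Us, W, m, hUs0, hlaw, hWm, hmb, hzero, hnegm, hdev⟩ := h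
  refine ⟨Us, W, m, hUs0, hlaw, hWm, hmb, hzero, hnegm, fun i hi => ?_⟩
  obtain ⟨hUi0, hUiU, hd⟩ := hdev i hi
  exact ⟨hUi0, hUiU, fun k hk k' hk' => by rw [← truncArr_apply_of_mem B (𝒜 i) hk hk']; exact hd k hk k' hk'⟩

end Summit.HubbardSuperconductivity.HubbardSuperconductivity.Theorems.SWaveCascade

end
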